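import Mathlib
import HarnessLib
import Summits.NavierStokesRegularity.NavierStokesRegularity.Theorems.TypeIQuarterGateScarEnvelopeTypeIForcedTsaiAlgSemantics
import Summits.NavierStokesRegularity.NavierStokesRegularity.Theorems.TypeIQuarterGateScarEnvelopeTypeIForcedTsaiFieldResidual

/-!
# ARM B lane E-exact, Type-I-tail class — FIELD CALCULUS of the 5-monomial algebra:
  `∂_j` of `kbase`, `v^h = kbase^{−h/2}`, of 5-monomials and 5-polynomials is the value of the symbolic
  `Poly5.deriv`; smoothness; `curl`, `Δ`, `D·[y]`, `(U·∇)U` of a symbolic field `evalVec5 τ V` are the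
  values of `curl5 / lap5 / ydot5 / conv5`; hence the vorticity residual of `U = evalVec5 τ u` is
  `evalVec5 τ g` with the checker's `g = curl5 (lin5 u) + curl5 (conv5 u)`.

Mirrors `…ForcedTsaiFieldCalculus` / `…ForcedTsaiFieldResidual` (Gaussian class) with the algebraic kernel
`v = (1+|y|²/τ²)^{−1/2}` in place of `e^{−a|y|²}`.  Nothing here bears on NS regularity.
-/

noncomputable section

set_option linter.dupNamespace false

namespace Summit.NavierStokesRegularity.NavierStokesRegularity.Cruxes.ScarEnvelopeTypeI.ForcedTsai

open MeasureTheory Set Metric Real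
open scoped RealInnerProductSpace ContDiff Laplacian
open Literature.Analysis.FluidPDE

/-! ## The kernel `kbase`, `vpow` -/

/-- `kbase` through `tPoly`. -/
theorem kbase_eq (τ : ℝ) : kbase τ = fun y => 1 + (τ ^ 2)⁻¹ * QPoly.eval tPoly y := by
  funext y; rw [kbase, eval_tPoly]; ring

/-- `kbase` is smooth. -/
theorem contDiff_kbase (τ : ℝ) {n : WithTop ℕ∞} : ContDiff ℝ n (kbase τ) := by
  rw [kbase_eq]; exact contDiff_const.add (contDiff_const.mul (QPoly.contDiff_eval tPoly))

/-- `kbase` is differentiable. -/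
theorem differentiableAt_kbase (τ : ℝ) (y : E3) : DifferentiableAt ℝ (kbase τ) y :=
  (contDiff_kbase τ (n := 1)).differentiable one_ne_zero y

/-- `∂_j kbase = 2 y_j / τ²`. -/
theorem fderiv_kbase_single (τ : ℝ) (y : E3) (j : Fin 3) :
    fderiv ℝ (kbase τ) y (EuclideanSpace.single j 1) = 2 * y j / τ ^ 2 := by
  rw [kbase_eq]
  rw [show (fun y : E3 => 1 + (τ ^ 2)⁻¹ * QPoly.eval tPoly y) = fun y => (1 : ℝ) + (fun y => (τ ^ 2)⁻¹ * QPoly.eval tPoly y) y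
      from rfl, fderiv_const_add, fderiv_const_mul (QPoly.differentiableAt_eval tPoly y)]
  simp only [FunLike.coe_smul, Pi.smul_apply, smul_eq_mul]
  rw [QPoly.fderiv_eval_single, eval_deriv_tPoly]
  ring

/-- `v^h` is smooth. -/
theorem contDiff_vpow (τ : ℝ) (h : ℕ) {n : WithTop ℕ∞} : ContDiff ℝ n (vpow τ h) := by
  unfold vpow; exact (contDiff_kbase τ).rpow_const_of_ne fun y => (kbase_pos τ y).ne'

/-- `v^h` is differentiable. -/
theorem differentiableAt_vpow (τ : ℝ) (h : ℕ) (y : E3) : DifferentiableAt ℝ (vpow τ h) y :=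
  (contDiff_vpow τ h (n := 1)).differentiable one_ne_zero y

/-- `∂_j v^h = −(h/τ²)·y_j·v^{h+2}`. -/
theorem fderiv_vpow_single (τ : ℝ) (h : ℕ) (y : E3) (j : Fin 3) :
    fderiv ℝ (vpow τ h) y (EuclideanSpace.single j 1) = -((h : ℝ) / τ ^ 2) * y j * vpow τ (h + 2) y := by
  have hk := kbase_pos τ y
  have hF := (differentiableAt_kbase τ y).hasFDerivAt.rpow_const (p := -(h : ℝ) / 2) (Or.inl hk.ne')
  rw [show vpow τ h = fun y => kbase τ y ^ (-(h : ℝ) / 2) from rfl, hF.fderiv]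
  simp only [FunLike.coe_smul, Pi.smul_apply, smul_eq_mul]
  rw [fderiv_kbase_single, vpow]
  have : kbase τ y ^ (-(h : ℝ) / 2 - 1) = kbase τ y ^ (-((h + 2 : ℕ) : ℝ) / 2) := by
    congr 1; push_cast; ring
  rw [this]; ring

/-! ## 5-monomials -/

/-- 5-monomials are smooth. -/
theorem Mono5.contDiff_eval (τ : ℝ) (m : Mono5) {n : WithTop ℕ∞} : ContDiff ℝ n (fun y : E3 => Mono5.eval τ m y) := by
  have : (fun y : E3 => Mono5.eval τ m y) = fun y => Mono.eval m.yMono y * (QPoly.eval tPoly y) ^ m.et * vpow τ m.eh y :=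
    funext fun y => Mono5.eval_eq τ m y
  rw [this]
  exact ((Mono.contDiff_eval _).mul ((QPoly.contDiff_eval tPoly).pow _)).mul (contDiff_vpow τ _)

/-- 5-monomials are differentiable. -/
theorem Mono5.differentiableAt_eval (τ : ℝ) (m : Mono5) (y : E3) :
    DifferentiableAt ℝ (fun y : E3 => Mono5.eval τ m y) y :=
  (Mono5.contDiff_eval τ m (n := 1)).differentiable one_ne_zero y

/-- Value of `derivY`. -/
theorem evalOpt_derivY (τ : ℝ) (j : Fin 3) (m : Mono5) (y : E3) :
    evalOpt τ (Mono5.derivY j m) y = Mono.pd j m.yMono y * (QPoly.eval tPoly y) ^ m.et * vpow τ m.eh y := by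
  fin_cases j
  · by_cases he : m.e1 = 0
    · simp [evalOpt, Mono5.derivY, he, Mono.pd_zero, Mono5.yMono]
    · simp [evalOpt, Mono5.derivY, he, Mono.pd_zero, Mono5.yMono, Mono5.eval_eq, Mono.eval]
  · by_cases he : m.e2 = 0
    · simp [evalOpt, Mono5.derivY, he, Mono.pd_one, Mono5.yMono]
    · simp [evalOpt, Mono5.derivY, he, Mono.pd_one, Mono5.yMono, Mono5.eval_eq, Mono.eval]
  · by_cases he : m.e3 = 0
    · simp [evalOpt, Mono5.derivY, he, Mono.pd_two, Mono5.yMono]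
    · simp [evalOpt, Mono5.derivY, he, Mono.pd_two, Mono5.yMono, Mono5.eval_eq, Mono.eval]

/-- Value of `derivT`. -/
theorem evalOpt_derivT (τ : ℝ) (j : Fin 3) (m : Mono5) (y : E3) :
    evalOpt τ (Mono5.derivT j m) y =
      Mono.eval m.yMono y * ((m.et : ℝ) * (QPoly.eval tPoly y) ^ (m.et - 1) * (2 * y j)) * vpow τ m.eh y := by
  unfold Mono5.derivT
  by_cases he : m.et = 0
  · simp [evalOpt, he]
  · obtain ⟨k, hk⟩ := Nat.exists_eq_succ_of_ne_zero he
    rw [hk]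
    simp only [Nat.succ_ne_zero, ↓reduceIte, evalOpt, Nat.succ_sub_one]
    rw [Mono5.eval_mulVar, Mono5.eval_eq]
    simp only [Mono5.yMono, Mono.eval]
    push_cast
    ring

/-- Value of `derivV` (`τ2 = τ²`). -/
theorem evalOpt_derivV {τ : ℝ} {τ2 : ℚ} (hτ2 : (τ2 : ℝ) = τ ^ 2) (j : Fin 3) (m : Mono5) (y : E3) :
    evalOpt τ (Mono5.derivV τ2 j m) y =
      Mono.eval m.yMono y * (QPoly.eval tPoly y) ^ m.et * (-((m.eh : ℝ) / τ ^ 2) * y j * vpow τ (m.eh + 2) y) := by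
  unfold Mono5.derivV
  by_cases he : m.eh = 0
  · simp [evalOpt, he]
  · simp only [he, ↓reduceIte, evalOpt, Mono5.eval_mulVar]
    rw [Mono5.eval_eq]
    simp only [Mono5.yMono, Mono.eval]
    push_cast
    rw [hτ2]
    ring

/-- **`∂_j` of a 5-monomial is the value of its three symbolic derivative parts** (`τ2 = τ²`). -/
theorem Mono5.fderiv_eval_single {τ : ℝ} {τ2 : ℚ} (hτ2 : (τ2 : ℝ) = τ ^ 2) (m : Mono5) (y : E3) (j : Fin 3) :
    fderiv ℝ (fun y : E3 => Mono5.eval τ m y) y (EuclideanSpace.single j 1) =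
      evalOpt τ (Mono5.derivY j m) y + evalOpt τ (Mono5.derivT j m) y + evalOpt τ (Mono5.derivV τ2 j m) y := by
  have hfun : (fun y : E3 => Mono5.eval τ m y) =
      fun y => Mono.eval m.yMono y * (QPoly.eval tPoly y) ^ m.et * vpow τ m.eh y :=
    funext fun y => Mono5.eval_eq τ m y
  have hA := (Mono.differentiableAt_eval m.yMono y).hasFDerivAt
  have hB : HasFDerivAt (fun y : E3 => (QPoly.eval tPoly y) ^ m.et)
      (((m.et : ℝ) * (QPoly.eval tPoly y) ^ (m.et - 1)) • fderiv ℝ (fun y : E3 => QPoly.eval tPoly y) y) y :=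
    (hasDerivAt_pow m.et (QPoly.eval tPoly y)).comp_hasFDerivAt y (QPoly.differentiableAt_eval tPoly y).hasFDerivAt
  have hC := (differentiableAt_vpow τ m.eh y).hasFDerivAt
  have h : HasFDerivAt (fun y : E3 => Mono.eval m.yMono y * (QPoly.eval tPoly y) ^ m.et * vpow τ m.eh y) _ y :=
    (hA.mul hB).mul hC
  rw [hfun, h.fderiv]
  simp only [FunLike.coe_add, FunLike.coe_smul, Pi.add_apply, Pi.smul_apply, Pi.mul_apply, smul_eq_mul]
  rw [Mono.fderiv_eval_single, QPoly.fderiv_eval_single, eval_deriv_tPoly, fderiv_vpow_single, evalOpt_derivY,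
    evalOpt_derivT, evalOpt_derivV hτ2]
  ring

/-! ## 5-polynomials -/

/-- 5-polynomials are smooth. -/
theorem Poly5.contDiff_eval (τ : ℝ) (P : Poly5) {n : WithTop ℕ∞} : ContDiff ℝ n (fun y : E3 => Poly5.eval τ P y) := by
  induction P with
  | nil => simpa using contDiff_const
  | cons m P ih =>
    have : (fun y : E3 => Poly5.eval τ (m :: P) y) = fun y => Mono5.eval τ m y + Poly5.eval τ P y := by funext y; simp
    rw [this]; exact (Mono5.contDiff_eval τ m).add ih

/-- 5-polynomials are differentiable. -/
theorem Poly5.differentiableAt_eval (τ : ℝ) (P : Poly5) (y : E3) : DifferentiableAt ℝ (fun y : E3 => Poly5.eval τ P y) y :=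
  (Poly5.contDiff_eval τ P (n := 1)).differentiable one_ne_zero y

/-- Value of a `filterMap` of optional monomials. -/
theorem Poly5.eval_filterMap (τ : ℝ) (f : Mono5 → Option Mono5) (P : Poly5) (y : E3) :
    Poly5.eval τ (P.filterMap f) y = (P.map fun m => evalOpt τ (f m) y).sum := by
  induction P with
  | nil => simp
  | cons m P ih =>
    rw [List.filterMap_cons, List.map_cons, List.sum_cons]
    cases hf : f m with
    | none => simp [evalOpt, ih]
    | some m' => simp [evalOpt, ih]

/-- **`∂_j` of a 5-polynomial's value is the value of `Poly5.deriv τ2 j`** (`τ2 = τ²`). -/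
theorem Poly5.fderiv_eval_single {τ : ℝ} {τ2 : ℚ} (hτ2 : (τ2 : ℝ) = τ ^ 2) (P : Poly5) (y : E3) (j : Fin 3) :
    fderiv ℝ (fun y : E3 => Poly5.eval τ P y) y (EuclideanSpace.single j 1) = Poly5.eval τ (Poly5.deriv τ2 j P) y := by
  rw [Poly5.deriv, Poly5.eval_append, Poly5.eval_append, Poly5.eval_filterMap, Poly5.eval_filterMap,
    Poly5.eval_filterMap]
  induction P with
  | nil => simp
  | cons m P ih =>
    have hfun : (fun y : E3 => Poly5.eval τ (m :: P) y) = (fun y => Mono5.eval τ m y) + fun y => Poly5.eval τ P y := by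
      funext y; simp
    rw [hfun, fderiv_add (Mono5.differentiableAt_eval τ m y) (Poly5.differentiableAt_eval τ P y)]
    simp only [FunLike.coe_add, Pi.add_apply, List.map_cons, List.sum_cons]
    rw [Mono5.fderiv_eval_single hτ2, ih]
    ring

/-! ## Symbolic vector fields -/

/-- Symbolic vector fields are smooth. -/
theorem contDiff_evalVec5 (τ : ℝ) (V : Fin 3 → Poly5) {n : WithTop ℕ∞} : ContDiff ℝ n (evalVec5 τ V) :=
  contDiff_euclidean.mpr fun i => by
    have : (fun y => evalVec5 τ V y i) = fun y => Poly5.eval τ (V i) y := funext fun y => evalVec5_apply τ V y i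
    rw [this]; exact Poly5.contDiff_eval τ (V i)

/-- Symbolic vector fields are differentiable. -/
theorem differentiableAt_evalVec5 (τ : ℝ) (V : Fin 3 → Poly5) (y : E3) : DifferentiableAt ℝ (evalVec5 τ V) y :=
  (contDiff_evalVec5 τ V (n := 1)).differentiable one_ne_zero y

/-- `∂_j` of the `i`-th component of a symbolic field. -/
theorem fderiv_evalVec5_single {τ : ℝ} {τ2 : ℚ} (hτ2 : (τ2 : ℝ) = τ ^ 2) (V : Fin 3 → Poly5) (y : E3) (i j : Fin 3) :
    fderiv ℝ (evalVec5 τ V) y (EuclideanSpace.single j 1) i = Poly5.eval τ (Poly5.deriv τ2 j (V i)) y := by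
  rw [← fderiv_apply_coord_vec3 (differentiableAt_evalVec5 τ V y) i]
  have : (fun y => evalVec5 τ V y i) = fun y => Poly5.eval τ (V i) y := funext fun y => evalVec5_apply τ V y i
  rw [this, Poly5.fderiv_eval_single hτ2]

/-- The directional derivative `D(evalVec5 V)(y)[w]`, componentwise. -/
theorem fderiv_evalVec5_apply {τ : ℝ} {τ2 : ℚ} (hτ2 : (τ2 : ℝ) = τ ^ 2) (V : Fin 3 → Poly5) (y w : E3) (i : Fin 3) :
    fderiv ℝ (evalVec5 τ V) y w i = ∑ j : Fin 3, w j * Poly5.eval τ (Poly5.deriv τ2 j (V i)) y := by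
  rw [← fderiv_apply_coord_vec3 (differentiableAt_evalVec5 τ V y) i, clm_apply_eq_sum]
  refine Finset.sum_congr rfl fun j _ => ?_
  rw [fderiv_apply_coord_vec3 (differentiableAt_evalVec5 τ V y) i, fderiv_evalVec5_single hτ2]

/-- **Curl of a symbolic field**: `curl (evalVec5 τ V) = evalVec5 τ (curl5 τ2 V)`. -/
theorem curl_evalVec5 {τ : ℝ} {τ2 : ℚ} (hτ2 : (τ2 : ℝ) = τ ^ 2) (V : Fin 3 → Poly5) (y : E3) :
    curl (evalVec5 τ V) y = evalVec5 τ (curl5 τ2 V) y := by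
  have hD := fderiv_evalVec5_single hτ2 V y
  ext k
  simp only [curl, evalVec5, curl5, PiLp.toLp_apply]
  fin_cases k
  · simp only [Fin.zero_eta, Fin.isValue, Matrix.cons_val_zero, hD, Poly5.eval_norm, Poly5.eval_sub]
  · simp only [Fin.mk_one, Fin.isValue, Matrix.cons_val_one, Matrix.cons_val_zero, hD, Poly5.eval_norm, Poly5.eval_sub]
  · simp only [Fin.reduceFinMk, Fin.isValue, Matrix.cons_val, hD, Poly5.eval_norm, Poly5.eval_sub]

/-- The Laplacian of a symbolic field, componentwise: `(Δ evalVec5 V)_i = eval (lap5 (V i))`. -/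
theorem laplacian_evalVec5_apply {τ : ℝ} {τ2 : ℚ} (hτ2 : (τ2 : ℝ) = τ ^ 2) (V : Fin 3 → Poly5) (y : E3) (i : Fin 3) :
    (Δ (evalVec5 τ V)) y i = Poly5.eval τ (lap5 τ2 (V i)) y := by
  rw [laplacian_apply_coord_vec3 (contDiff_evalVec5 τ V (n := 2)) y i]
  have hUi : (fun y => evalVec5 τ V y i) = fun y => Poly5.eval τ (V i) y := funext fun y => evalVec5_apply τ V y i
  rw [hUi]
  have hΦ : ContDiff ℝ 2 (fun y => Poly5.eval τ (V i) y) := Poly5.contDiff_eval τ _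
  have hlap : (Δ (fun y => Poly5.eval τ (V i) y)) y =
      ∑ j : Fin 3, fderiv ℝ (fun y => fderiv ℝ (fun y => Poly5.eval τ (V i) y) y
        (EuclideanSpace.basisFun (Fin 3) ℝ j)) y (EuclideanSpace.basisFun (Fin 3) ℝ j) := by
    rw [InnerProductSpace.laplacian_eq_iteratedFDeriv_orthonormalBasis _ (EuclideanSpace.basisFun (Fin 3) ℝ)]
    refine Finset.sum_congr rfl fun j _ => ?_
    rw [iteratedFDeriv_two_apply]
    have hd : DifferentiableAt ℝ (fderiv ℝ (fun y => Poly5.eval τ (V i) y)) y :=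
      ((hΦ.fderiv_right (m := 1) (by norm_num)).differentiable one_ne_zero) y
    rw [fderiv_clm_apply hd (differentiableAt_const _), fderiv_const_apply]
    simp
  rw [hlap, Fin.sum_univ_three]
  simp only [EuclideanSpace.basisFun_apply]
  have hinner : ∀ j : Fin 3, (fun y => fderiv ℝ (fun y => Poly5.eval τ (V i) y) y (EuclideanSpace.single j 1)) =
      fun y => Poly5.eval τ (Poly5.deriv τ2 j (V i)) y :=
    fun j => funext fun y => Poly5.fderiv_eval_single hτ2 (V i) y j
  rw [hinner 0, hinner 1, hinner 2, Poly5.fderiv_eval_single hτ2, Poly5.fderiv_eval_single hτ2,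
    Poly5.fderiv_eval_single hτ2, lap5, Poly5.eval_add, Poly5.eval_add]

/-- The momentum residual of a symbolic field is `evalVec5 (lin5 u) + evalVec5 (conv5 u)`. -/
theorem momentumResidual_evalVec5 {τ : ℝ} {τ2 : ℚ} (hτ2 : (τ2 : ℝ) = τ ^ 2) (u : Fin 3 → Poly5) :
    lerayMomentumResidual (evalVec5 τ u) =
      fun y => evalVec5 τ (lin5 τ2 u) y + evalVec5 τ (conv5 τ2 u) y := by
  funext y
  ext i
  rw [PiLp.add_apply, evalVec5_apply, evalVec5_apply, lerayMomentumResidual]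
  simp only [PiLp.add_apply, PiLp.neg_apply, PiLp.smul_apply, smul_eq_mul, convect]
  rw [laplacian_evalVec5_apply hτ2, evalVec5_apply, fderiv_evalVec5_apply hτ2, fderiv_evalVec5_apply hτ2,
    Fin.sum_univ_three, Fin.sum_univ_three, evalVec5_apply, evalVec5_apply, evalVec5_apply]
  have hlin : Poly5.eval τ (lin5 τ2 u i) y =
      -Poly5.eval τ (lap5 τ2 (u i)) y + (1 / 2 : ℝ) * Poly5.eval τ (u i) y +
        (1 / 2 : ℝ) * (y 0 * Poly5.eval τ (Poly5.deriv τ2 0 (u i)) y + y 1 * Poly5.eval τ (Poly5.deriv τ2 1 (u i)) y +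
          y 2 * Poly5.eval τ (Poly5.deriv τ2 2 (u i)) y) := by
    simp only [lin5, ydot5, Poly5.eval_norm, Poly5.eval_add, Poly5.eval_scale, Poly5.eval_mulVar]
    push_cast; ring
  have hnl : Poly5.eval τ (conv5 τ2 u i) y =
      Poly5.eval τ (u 0) y * Poly5.eval τ (Poly5.deriv τ2 0 (u i)) y +
        Poly5.eval τ (u 1) y * Poly5.eval τ (Poly5.deriv τ2 1 (u i)) y +
        Poly5.eval τ (u 2) y * Poly5.eval τ (Poly5.deriv τ2 2 (u i)) y := by
    simp only [conv5, Poly5.eval_norm, Poly5.eval_add, Poly5.eval_mul]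
  rw [hlin, hnl]

/-- **The vorticity residual of a symbolic field**:
`lerayVorticityResidual (evalVec5 τ u) y = evalVec5 τ (fun i => curl5 (lin5 u) i + curl5 (conv5 u) i) y`. -/
theorem vorticityResidual_evalVec5 {τ : ℝ} {τ2 : ℚ} (hτ2 : (τ2 : ℝ) = τ ^ 2) (u : Fin 3 → Poly5) (y : E3) :
    lerayVorticityResidual (evalVec5 τ u) y =
      evalVec5 τ (fun i => Poly5.add (curl5 τ2 (lin5 τ2 u) i) (curl5 τ2 (conv5 τ2 u) i)) y := by
  rw [lerayVorticityResidual, momentumResidual_evalVec5 hτ2,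
    curl_add_apply (differentiableAt_evalVec5 τ _ y) (differentiableAt_evalVec5 τ _ y),
    curl_evalVec5 hτ2, curl_evalVec5 hτ2]
  ext i
  simp

end Summit.NavierStokesRegularity.NavierStokesRegularity.Cruxes.ScarEnvelopeTypeI.ForcedTsai

end
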